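import Literature.NumberTheory.EllipticCurves.ComplexMultiplicationCoatesWilesSeparationProofs
import Literature.NumberTheory.EllipticCurves.DivisionPolynomialMultiplication
import Summits.BirchSwinnertonDyer.Rank1Residual.GaloisImage.LocalThreeTorsionCount
import HarnessLib

/-!
# `3`-torsion of `E(ℚ_ℓ)` on an integral model, `ℓ ≠ 3`: the `x`-coordinates are `ℓ`-adic
# integers (team n1011, row T-LOC3L, FILE L2 — the `ℓ ≠ 3` twin of T-LOC3T FILE B)

HONEST FRAMING (cell `b2b-bsdres`, run/shared/lean/b2b/bsd-rank1-residual/, verbatim in every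
file): the goal of the cell is to DELETE the COMBINATION-SHAPED residual classes of the
Birch–Swinnerton-Dyer formula for ALL analytic-rank `≤ 1` elliptic curves over `ℚ` — "full BSD
formula for every rank `≤ 1` curve in class `C`" assembled STRICTLY from published theorems — so
that the rank-`≤ 1` remainder becomes exactly the CONSTRUCTION-SHAPED classes, which are TYPED
(missing-input `Prop`s), NOT attempted. This is not "finishing BSD". Team n1011 (N10/N11): research
route; this file is a TOOL (local arithmetic of `E(ℚ_ℓ)`); nothing is booked by it; no mark / label
moved. THEOREMS ONLY: no definition, no named fact, no `sorry`.

## What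

For a prime `ℓ` (any `ℓ`, including `2`), a Weierstrass equation `E` over `ℚ_ℓ` with `ℓ`-integral
coefficients (`[E.IsIntegral ℤ_[ℓ]]`) and `Δ ≠ 0`:

* `three_nsmul_some_eq_zero_iff_eval_Ψ₃` — an affine point `P = (x, y)` satisfies `3P = O` iff
  `Ψ₃(x) = 0` (the tree's PROVED `Affine.Point.zsmul_some_eq_zero_iff`, Silverman *AEC* Ex. 3.7,
  with Mathlib's `ψ 3 = C Ψ₃`; field-generic — restated over `ℚ_ℓ` for the consumer).
* **`norm_le_one_of_three_nsmul_eq_zero`** (`ℓ ≠ 3`) — such a point has `‖x‖_ℓ ≤ 1`. Proof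
  (AEC VII.3.1 with `m = 3`): otherwise `P ∈ E₁(ℚ_ℓ)` and the tree's
  `‖z(mP)‖ = ‖z(P)‖` for `ℓ ∤ m` (`WeierstrassCurve.norm_formalParameter_nsmul_of_not_dvd`,
  AEC IV.2.3(a) / IV.3.2(b): `Ê(ℓℤ_ℓ)` has no prime-to-`ℓ` torsion) gives `z(P) = z(3P) = 0`,
  i.e. `P = O`. No `ℓ ≠ 2` hypothesis. (At `ℓ = 3` the statement also holds — T-LOC3T FILE B
  `LocalTorsion3.norm_le_one_of_three_nsmul_eq_zero`, by a `3`-specific domination argument.)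
* `not_isInReductionKernel_of_three_nsmul_eq_zero` — the same for an abstract point `P ≠ O`:
  a non-zero `3`-torsion point is not in the kernel of reduction `E₁(ℚ_ℓ)` (`ℓ ≠ 3`);
  `norm_le_one_of_equation_of_eval_Ψ₃` — the `Ψ₃`-phrased corollary used by FILE L3.

Consumer: FILE L3 `LocalThreeTorsionDeciderAt` (`#E(ℚ_ℓ)[3] = 1 + 2·#{roots of Ψ₃ in ℤ_ℓ
with g a non-zero square}`), the `ℓ ≠ 3` leg of the T-VIS3 certificate binder
`hloc : ∀ v ∈ S, #E′(ℚ_v)[3] = 1` (p04 `GaloisImage/VisibleLowerBoundThree.lean`, via p18's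
`ℚ_[p] ↔ v.adicCompletion ℚ` bridge). References: [SilvermanAEC2009] III Ex. 3.7, IV.3.2, VII.3.1.
-/

set_option autoImplicit false

noncomputable section

open scoped Classical
open Polynomial WeierstrassCurve

namespace Summit.BirchSwinnertonDyer.Rank1Residual.GaloisImage.LocalTorsion3At

section Padic

variable {p : ℕ} [hp : Fact p.Prime] (E : WeierstrassCurve ℚ_[p]) [hE : E.IsIntegral ℤ_[p]]

omit hE in
/-- **`3P = O ⟺ Ψ₃(x(P)) = 0`** for an affine point `P = (x, y)` of `E/ℚ_ℓ`
(Silverman AEC Ex. 3.7(f), the tree's `Affine.Point.zsmul_some_eq_zero_iff`, with `ψ₃ = C Ψ₃`).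
[cite: SilvermanAEC2009, Exercise 3.7(f)] -/
theorem three_nsmul_some_eq_zero_iff_eval_Ψ₃ {x y : ℚ_[p]} (h : E.toAffine.Nonsingular x y) :
    (3 : ℕ) • (Affine.Point.some x y h : E.toAffine.Point) = 0 ↔ E.Ψ₃.eval x = 0 := by
  have key := Affine.Point.zsmul_some_eq_zero_iff h (3 : ℤ)
  rw [show ((3 : ℤ)) = ((3 : ℕ) : ℤ) by rfl, natCast_zsmul] at key
  rw [key, show ((3 : ℕ) : ℤ) = 3 by rfl, WeierstrassCurve.ψ_three, evalEval_C]

variable [E.IsElliptic]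

/-- **A non-zero `3`-torsion point of `E(ℚ_ℓ)`, `ℓ ≠ 3`, is not in the kernel of reduction**
(`Ê(ℓℤ_ℓ)` has no prime-to-`ℓ` torsion: `‖z(3P)‖ = ‖z(P)‖`). [Silverman AEC IV.3.2(b), VII.3.1]
[cite: SilvermanAEC2009, VII.3.1] -/
theorem not_isInReductionKernel_of_three_nsmul_eq_zero (hp3 : p ≠ 3) {P : E.toAffine.Point}
    (hP0 : P ≠ 0) (h3 : (3 : ℕ) • P = 0) : ¬ E.IsInReductionKernel P := by
  intro hPk
  have hnd : ¬ p ∣ 3 := fun hd =>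
    hp3 ((Nat.prime_dvd_prime_iff_eq hp.out Nat.prime_three).mp hd)
  have key := E.norm_formalParameter_nsmul_of_not_dvd hnd hPk
  rw [h3, E.formalParameter_zero, norm_zero] at key
  exact hP0 ((E.formalParameter_eq_zero_iff hPk).mp (norm_eq_zero.mp key.symm))

/-- **The `x`-coordinate of a `ℚ_ℓ`-rational `3`-torsion point of an `ℓ`-integral equation is an
`ℓ`-adic integer**, for every prime `ℓ ≠ 3` (including `ℓ = 2`).
[Silverman AEC IV.3.2(b), VII.2.2, VII.3.1] [cite: SilvermanAEC2009, VII.3.1] -/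
theorem norm_le_one_of_three_nsmul_eq_zero (hp3 : p ≠ 3) {x y : ℚ_[p]}
    (h : E.toAffine.Nonsingular x y)
    (h3 : (3 : ℕ) • (Affine.Point.some x y h : E.toAffine.Point) = 0) : ‖x‖ ≤ 1 := by
  by_contra hx
  rw [not_le] at hx
  exact not_isInReductionKernel_of_three_nsmul_eq_zero E hp3 (P := Affine.Point.some x y h)
    (by rintro ⟨⟩) h3 ((E.isInReductionKernel_some h).mpr hx)

/-- Corollary in `Ψ₃`-language: a root `x ∈ ℚ_ℓ` of `Ψ₃` carrying a point of `E(ℚ_ℓ)` is an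
`ℓ`-adic integer (`ℓ ≠ 3`). [cite: SilvermanAEC2009, VII.3.1] -/
theorem norm_le_one_of_equation_of_eval_Ψ₃ (hp3 : p ≠ 3) {x y : ℚ_[p]}
    (heq : E.toAffine.Equation x y) (hΨ : E.Ψ₃.eval x = 0) : ‖x‖ ≤ 1 := by
  have hns : E.toAffine.Nonsingular x y := (Affine.equation_iff_nonsingular).mp heq
  exact norm_le_one_of_three_nsmul_eq_zero E hp3 hns
    ((three_nsmul_some_eq_zero_iff_eval_Ψ₃ E hns).mpr hΨ)

end Padic

end Summit.BirchSwinnertonDyer.Rank1Residual.GaloisImage.LocalTorsion3At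

end
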